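import Summits.BirchSwinnertonDyer.BirchSwinnertonDyer.Theorems.ManinLocalTwoThreeThreeDvdModularDegree
import HarnessLib

/-!
# `a_p(E) = +1` at conductor `4p` forces `3 ∣ deg φ` — a census-checkable corollary of E-an-46

Summit `BirchSwinnertonDyer`, sub-problem `BirchSwinnertonDyer`, route `ManinLocalTwoThree`; width seat `bsd-line-manin23-p2`
(gen 8), `--supports` crux C2 `ManinOddAtFour` (stmt-BirchSwinnertonDyer-22967).  Cell `bsd-f2-manin`, analytic lens rows
E-an-45/46/83 (MEMO-an §55/§60) and refuter-1 §R59 F-3 («`a_p = +1 ⇒ R = O`, so `R ≠ O ⇒ a_p = −1`», engine 29/29).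

PROVED here (sorry-free, axioms standard), `p` an odd prime, level `4p`:
* `modularSymbol_one_div_p_mem_periodLattice_of_atkinLehner_eq_neg` — `w_p f = −f ⟹ {∞,1/p}_f ∈ Λ_f` (three-term
  Atkin–Lehner relation at `Q = p` (the seat's `modularSymbol_atkinLehnerW_smul`) + the hexagon clauses (ii),(iii) of the
  seat's `cusp_relations_of_isNewform0_four_mul`);
* `atkinLehnerInvolution_p_eq_neg_of_cuspCoeff_eq_one` — `a_p(f) = 1 ⟹ w_p f = −f` (Knapp Thm. 9.27, tree);
* **`three_dvd_modularDegree_of_atkinLehner_eq_neg`**, **`three_dvd_modularDegree_of_lFunction_p_eq_one`** — for EVERY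
  `X₀(4p)`-parametrisation datum `D` of any elliptic `W` with `a_p(W) = +1` (split multiplicative reduction at `p`):
  **`3 ∣ deg φ_D`**, via the seat's E-an-46 `threeDvdModularDegreeOfCuspImageZero_holds`.

BSD is not proved by this; Manin's conjecture is not proved by this.
-/

set_option autoImplicit false
-- `Summit.BirchSwinnertonDyer.BirchSwinnertonDyer` is the mandated summit-side namespace (single-conjunct summit).
set_option linter.dupNamespace false

noncomputable section

open scoped MatrixGroups ModularForm
open CongruenceSubgroup Matrix.SpecialLinearGroup UpperHalfPlane
open Literature.NumberTheory.EllipticCurves Literature.NumberTheory.EllipticCurves.ModularForms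
open Summit.BirchSwinnertonDyer.Rank1Residual.ManinAdditive

namespace Summit.BirchSwinnertonDyer.BirchSwinnertonDyer.Theorems.ManinLocalTwoThree

/-- **`w_p f = −f` at level `4p` forces `{∞, 1/p}_f ∈ Λ_f`** (refuter-1 §R59 F-3 «`a_p = +1 ⇒ R = O`»): the three-term
Atkin–Lehner relation at `Q = p`, `r = 0` reads `{∞,1/p} ≡ −{∞,0} + {∞,¼}`, the hexagon gives `{∞,0} ≡ {∞,¼} + {∞,1/p}` and
`3{∞,1/p} ∈ Λ_f`; so `2{∞,1/p} ∈ Λ_f` and hence `{∞,1/p} ∈ Λ_f`. -/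
theorem modularSymbol_one_div_p_mem_periodLattice_of_atkinLehner_eq_neg {p : ℕ} [Fact p.Prime] [NeZero (4 * p)]
    (hp2 : p ≠ 2) {f : CuspForm (Gamma0 (4 * p)) 2} (hf : IsNewform0 f)
    (hw : atkinLehnerInvolution (4 * p) 2 p f = -f) :
    modularSymbol f (1 / (p : ℚ)) ∈ periodLattice f := by
  have hp : p.Prime := Fact.out
  haveI : NeZero p := ⟨hp.ne_zero⟩
  have hpodd : Odd p := hp.odd_of_ne_two hp2
  obtain ⟨m', hm'⟩ := hpodd
  have hpZ : (p : ℤ) = 2 * m' + 1 := by exact_mod_cast hm'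
  have hpne : (p : ℤ) ≠ 0 := by omega
  have hpN : p ∣ 4 * p := dvd_mul_left p 4
  have hdiv : 4 * p / p = 4 := Nat.mul_div_cancel 4 hp.pos
  have hcop : Nat.Coprime p (4 * p / p) := by
    rw [hdiv]
    have h2 : Nat.Coprime p 2 := (Nat.coprime_primes hp Nat.prime_two).mpr hp2
    simpa using h2.pow_right 2
  have hN : ((4 * p : ℕ) : ℤ) = 4 * (p : ℤ) := by push_cast; ring
  -- hexagon clauses (ii), (iii)
  obtain ⟨-, h3, h0, -, -⟩ := cusp_relations_of_isNewform0_four_mul ⟨m', hm'⟩ f hf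
  -- the Atkin–Lehner matrix `w(p) = (p x, y; 4p, p)`, `p x − 4 y = 1`
  set x : ℤ := atkinLehnerSL (4 * p) p 0 0 with hx
  set y : ℤ := atkinLehnerSL (4 * p) p 0 1 with hy
  have hbez : (p : ℤ) * x - 4 * y = 1 := by
    have h := atkinLehnerSL_bezout (4 * p) p hcop
    rw [hdiv] at h
    exact_mod_cast h
  have hε : atkinLehnerInvolution (4 * p) 2 p f = (-1 : ℂ) • f := by rw [hw, neg_one_smul]
  have hW0 := modularSymbol_atkinLehnerW_smul hpN hcop hε (0 : ℚ)
    (by rw [mul_zero, zero_add]; exact_mod_cast hp.ne_zero)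
  have qW0 : ((((p : ℕ) : ℚ) * (x : ℚ) * (0 : ℚ) + (y : ℚ)) / (((4 * p : ℕ) : ℚ) * (0 : ℚ) + ((p : ℕ) : ℚ)))
      = ((y : ℤ) : ℚ) / ((p : ℤ) : ℚ) := by
    push_cast
    ring
  have qx4 : ((x : ℚ) / (4 * p / p : ℕ)) = ((x : ℤ) : ℚ) / ((4 : ℤ) : ℚ) := by rw [hdiv]; push_cast; ring
  have qP : (1 / (p : ℚ)) = ((1 : ℤ) : ℚ) / ((p : ℤ) : ℚ) := by push_cast; ring
  have q4 : (1 / 4 : ℚ) = ((1 : ℤ) : ℚ) / ((4 : ℤ) : ℚ) := by norm_num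
  rw [qW0, qx4] at hW0
  rw [qP] at h3 h0 ⊢
  rw [q4] at h0
  set sP := modularSymbol f (((1 : ℤ) : ℚ) / ((p : ℤ) : ℚ)) with hsP
  set s4 := modularSymbol f (((1 : ℤ) : ℚ) / ((4 : ℤ) : ℚ)) with hs4
  set s0 := modularSymbol f 0 with hs0
  set A := modularSymbol f (((y : ℤ) : ℚ) / ((p : ℤ) : ℚ)) with hA
  set B := modularSymbol f (((x : ℤ) : ℚ) / ((4 : ℤ) : ℚ)) with hB
  -- `y/p ∼ 1/p` and `x/4 ∼ 1/4` under `Γ₀(4p)`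
  have l1 : A - sP ∈ periodLattice f :=
    modularSymbol_div_sub_div_mem_periodLattice f (a := y - (y - 1) * x * p) (b := (y - 1) * x)
      (c := 4 * p * (1 - y)) (d := 4 * y - 3) (by linear_combination (-(y - 1)) * hbez)
      ⟨1 - y, by rw [hN]⟩ 1 p y p hpne hpne (by ring_nf; exact hpne) (by ring)
  have l2 : B - s4 ∈ periodLattice f :=
    modularSymbol_div_sub_div_mem_periodLattice f (a := x + 4 * (x - 1) * y) (b := -((x - 1) * y))
      (c := 4 * p * (x - 1)) (d := 1 - p * (x - 1)) (by linear_combination (-(x - 1)) * hbez)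
      ⟨x - 1, by rw [hN]⟩ 1 4 x 4 (by norm_num) (by norm_num) (by ring_nf; norm_num) (by ring)
  -- `2 sP ∈ Λ_f`, then `sP = 3 sP − 2 sP`
  have h2 : (2 : ℂ) * sP ∈ periodLattice f := by
    have e : (2 : ℂ) * sP = (B - s4) - (A - sP) - (s0 - s4 - sP) := by linear_combination hW0
    rw [e]
    exact sub_mem (sub_mem l2 l1) h0
  have e : sP = 3 * sP - 2 * sP := by ring
  rw [e]
  exact sub_mem h3 h2

/-- **`w_p = −1` at conductor `4p` ⟹ `3 ∣ deg φ` for EVERY `X₀(4p)`-parametrisation** (E-an-46 `…_holds` applied: the cusp `1/p`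
maps to `O` because `{∞,1/p}_f ∈ Λ_f` and `c·Λ_f ⊆ Λ_W`). -/
theorem three_dvd_modularDegree_of_atkinLehner_eq_neg {p : ℕ} [Fact p.Prime] [NeZero (4 * p)] (hp2 : p ≠ 2)
    {W : WeierstrassCurve ℚ} [W.IsElliptic] (D : ModularParametrizationData W (4 * p))
    (hw : atkinLehnerInvolution (4 * p) 2 p D.f = -D.f) : 3 ∣ D.modularDegree := by
  have hp : p.Prime := Fact.out
  refine threeDvdModularDegreeOfCuspImageZero_holds W (hp.odd_of_ne_two hp2) D ?_
  rw [D.uniformize_eq_zero_iff]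
  exact D.smul_periodLattice_le _ (modularSymbol_one_div_p_mem_periodLattice_of_atkinLehner_eq_neg hp2 D.isNewformOf.1 hw)

/-- **`a_p(f) = +1` at level `4p` ⟹ `w_p f = −f`** (`λ(p) = −a_p` for `p ∥ N`, Knapp Thm. 9.27; tree
`IsNewform0.atkinLehnerEigenvalueAt_eq_neg_coeff_of_not_dvd`). -/
theorem atkinLehnerInvolution_p_eq_neg_of_cuspCoeff_eq_one {p : ℕ} [Fact p.Prime] [NeZero (4 * p)] (hp2 : p ≠ 2)
    {f : CuspForm (Gamma0 (4 * p)) 2} (hf : IsNewform0 f) (hap : cuspCoeff f p = 1) :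
    atkinLehnerInvolution (4 * p) 2 p f = -f := by
  have hp : p.Prime := Fact.out
  haveI : NeZero p := ⟨hp.ne_zero⟩
  have hN : 4 * p = p * 4 := Nat.mul_comm 4 p
  have hp4 : ¬ p ∣ 4 := by
    intro h
    have := (Nat.prime_dvd_prime_iff_eq hp Nat.prime_two).mp (hp.dvd_of_dvd_pow (show p ∣ 2 ^ 2 by simpa using h))
    exact hp2 this
  obtain ⟨ε, hε1, hε⟩ := hf.exists_atkinLehnerInvolutionAt_eq_smul_of_not_dvd p hN hp4
  have hf0 : f ≠ 0 := fun h0 ↦ hf.coe_ne_zero (by rw [h0]; rfl)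
  have hlam := hf.atkinLehnerEigenvalueAt_eq_neg_coeff_of_not_dvd p hN hp4
  rw [atkinLehnerEigenvalueAt_eq_of_eq_smul hf0 hε, show (qExpansion 1 ⇑f).coeff p = cuspCoeff f p from rfl,
    hap] at hlam
  have hfac : p ^ (4 * p).factorization p = p := by
    rw [hN, Nat.factorization_mul hp.ne_zero (by norm_num), Finsupp.add_apply, hp.factorization_self,
      Nat.factorization_eq_zero_of_not_dvd hp4, add_zero, pow_one]
  rw [← atkinLehnerInvolutionAt_eq (N := 4 * p) (k := 2) hfac, hε, hlam, neg_one_smul]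

/-- **SPLIT MULTIPLICATIVE AT `p` AND CONDUCTOR `4p` ⟹ `3 ∣ deg φ`**: for an elliptic `W` with an `X₀(4p)`-parametrisation
datum `D` (`p` an odd prime) and `a_p(W) = +1`, the modular degree of `D` is divisible by `3` — for EVERY datum, no
optimality.  (`a_p = +1 ⟹ w_p f = −f ⟹ {∞,1/p}_f ∈ Λ_f ⟹ φ_D([1/p]) = O ⟹` E-an-46.)  A `c`-free, census-checkable law
(refuter-1 §R59 F-3: `a_p = +1 ⇒ R = O`, engine 29/29).  BSD is not proved by this; Manin's conjecture is not proved by this. -/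
theorem three_dvd_modularDegree_of_lFunction_p_eq_one {p : ℕ} [Fact p.Prime] [NeZero (4 * p)] (hp2 : p ≠ 2)
    {W : WeierstrassCurve ℚ} [W.IsElliptic] (D : ModularParametrizationData W (4 * p))
    (hap : W.LFunction p = 1) : 3 ∣ D.modularDegree := by
  have hcoeff : cuspCoeff D.f p = 1 := by rw [D.isNewformOf.2 p, hap]; push_cast; rfl
  exact three_dvd_modularDegree_of_atkinLehner_eq_neg hp2 D
    (atkinLehnerInvolution_p_eq_neg_of_cuspCoeff_eq_one hp2 D.isNewformOf.1 hcoeff)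

end Summit.BirchSwinnertonDyer.BirchSwinnertonDyer.Theorems.ManinLocalTwoThree

end
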